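import Summits.QuantumFields.BalabanUV.Beta.GAN24.DerivativeRateTransferJensenMeanZero

/-!
# `BalabanUV.Beta.GAN24.DerivativeRateTransferJensenMeanZeroEnd` — binder row G-an2-4 ∕ (CONV-C), route R6 «VALUES, NOT DERIVATIVES», PART 48:
# ENDS OF THE CONSISTENT-PAIR COVARIANT JENSEN INEQUALITY — the consistent pair (`κ₂ ≤ c·κ²`: relative slack `O(κ)`, additive slack `O(κ³)`),
# the END fed by PART 22's loop letter verbatim, and THE ABELIAN DICTIONARY: loop angles of block mean ZERO (Bałaban's averaged coarse link
# `Ū = exp(i·mean_x θ_x)`, [CMP 95 (1.8)], [CMP 98 (42)]) ⟹ pointwise defect `κ = a`, mean defect `κ₂ ≤ a²` (unit b2b-balaban-gan24-p3, gen 42; v1)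

NOT IN PRINT; OUR PROOF (for the ROUTE; [folklore] real arithmetic + `2 × 2` rotation matrices — PART 47 BY NAME, `Real.one_sub_sq_div_two_le_cos`,
`Real.sin_lt`, `Real.sin_gt_sub_cube`, `Real.cos_sq_add_sin_sq`).  HONEST FRAMING (cell contract, verbatim): «discharging `BetaPertH` makes Bałaban's UV
stability UNCONDITIONAL — a real constructive-QFT result; it is NOT the continuum limit and NOT the Clay problem.»  HONEST DEPENDENCY (verbatim):
«continuum YM on T⁴ ⇐ BetaPertH ∧ nine spine estimates (0/9 proved); BetaPertH ⇐ (D1) ∧ (D4) ∧ CAP+tail; G-an2-4 gates asym, D1 and NE2/3/4.»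

WHY THIS FILE.  PART 47 (`DerivativeRateTransferJensenMeanZero.covJensen_meanZero`) proves, for transported block averagings with orthogonal
transporters, `⟨Qu,H_cQu⟩ ≤ (1 + t + (1+t⁻¹)(1+r)ϖκ²)⟨u,H_f u⟩ + (1+t⁻¹)(1+r⁻¹)κ₂²w_c d′⟨Qu,Qu⟩` with `κ` the POINTWISE and `κ₂` the block-MEAN
root-frame holonomy defect.  THIS FILE draws the two consequences the route reads: (§1) for a CONSISTENT pair `κ₂ ≤ c·κ²` the choice `t = κ`, `r = 1`
gives (STAB-ε,δ) with `ε = (1 + 2ϖ(1+κ))κ` and `δ = 2c²(1+κ)κ³·w_c d′` — THIRD order additive slack (PART 22 at the same `ε`: `δ = O(κ)`), and PART 22's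
own loop letter `|(V − 1)w| ≤ κ|w|` feeds PART 47's pointwise hypothesis; (§2) in the ABELIAN model (colour space `ℝ²`, transporters = rotations, so
every loop transport is a rotation `ρ(φ_x)` and the root-frame defect is `N_x = 1 − ρ(φ_x)`), the block weights `q ≥ 0`, `Σ_x q_x = 1` and loop angles
`|φ_x| ≤ a ≤ 1` WITH BLOCK MEAN ZERO `Σ_x q_x φ_x = 0` — which is what DEFINING the coarse link as Bałaban's average `Ū = exp(i·Σ_x q_x θ_x)` of the
loop transports `θ_x` does to the angles `φ_x = θ_x − θ̄` — give `|N_x w|² ≤ a²|w|²` (pointwise, `κ = a`) and `|(Σ_x q_x N_x) w|² ≤ (a²)²|w|²`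
(mean, `κ₂ = a² = κ²`, i.e. `c = 1`): `Σ_x q_x(1 − ρ(φ_x)) = A·1 − B·J` with `A = Σ_x q_x(1 − cos φ_x) ≤ a²/2`, `B = Σ_x q_x(sin φ_x − φ_x)`,
`|B| ≤ a³/4`, and `|(A·1 − B·J)w|² = (A² + B²)|w|²`.  For straight block-products the angles `φ_x` are the strip fluxes (one sign, mean `≍ a`): `κ₂ ≍ κ`,
no gain — gen 41's located dichotomy (R-gan24p3-g41-1; gan24-idea-1 g53 lens item 10 «CARTAN SPLIT»), now with letters and a proof.

WHAT THIS FILE PROVES (0 sorry, 0 `def`, nothing cited):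
* §1 `consistent_coeffs`, **`covJensen_consistent`** (`⟨Qu,H_cQu⟩ ≤ (1 + (1 + 2ϖ(1+κ))κ)⟨u,H_fu⟩ + 2c²(1+κ)κ³w_c d′⟨Qu,Qu⟩`),
  **`covJensen_meanZero_of_loop`** (PART 47's END from PART 22's `hV` + `R′` orthogonal).
* §2 the abelian dictionary: `rot_defect_self` (`|(1 − ρ(φ))w|² = (2 − 2cos φ)|w|²`), **`rot_defect_le_sq`** (`≤ φ²|w|²`), `abs_sin_sub_self_le`
  (`|sin φ − φ| ≤ |φ|³/4`), `wsum_rot_defect_self` (`|(Σ_x q_x(1 − ρ(φ_x)))w|² = (A² + B′²)|w|²`, `B′ = Σ q sin φ`),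
  **`wsum_rot_defect_le_of_mean_zero`** (`Σ_x q_xφ_x = 0`, `|φ_x| ≤ a ≤ 1` ⟹ `|(Σ_x q_x(1 − ρ(φ_x)))w|² ≤ (a²)²|w|²`).
* §3 **`covJensen_abelian_meanZero`** — THE ABELIAN END: PART 47's letters on `ℝ²` with every root-frame loop transport a rotation `ρ(φ(e′,x))`,
  `|φ| ≤ a ≤ 1`, block mean `Σ_x q(y,x)φ(e′,x) = 0`, `Σ_x q(y,x) = 1` ⟹ `⟨Qu,H_cQu⟩ ≤ (1 + (1 + 2ϖ(1+a))a)⟨u,H_fu⟩ + 2(1+a)a³·w_c d′·⟨Qu,Qu⟩`.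
WHAT IT DOES NOT DO: instantiate PART 47's letters on the lattice (taxi-tree Poincaré datum `Φ ∕ ϖ`; composite towers), treat the non-abelian `Ū` of
[CMP 98 (42)] (BCH corrections — the mean of the LOGARITHMS vanishes, the statement `κ₂ = O(κ²)` persists, not typed), or claim anything about (CONS) ∕
exact (STAB).  SUPPLIER work on route R6 (rank 2, REDUCTION, no seat); no consumer of record; NEVER «G-an2-4 closed»; NOT (CONV-C), NOT D1, NOT
`BetaPertH`, NOT continuum, NOT Clay.  Records: `HOME/b2b-balaban-gan24-p3/WOODBURY-FIBRE.md` v14.2. -/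

noncomputable section

open Matrix Finset

namespace Summit.QuantumFields.BalabanUV.Beta.GAN24.DerivativeRateTransferJensenMeanZeroEnd

open Summit.QuantumFields.BalabanUV.Beta.GAN24.DerivativeRateTransferLoewnerKKT (mulVec_dotProduct_eq)
open Summit.QuantumFields.BalabanUV.Beta.GAN24.DerivativeRateTransferJensenChain
open Summit.QuantumFields.BalabanUV.Beta.GAN24.DerivativeRateTransferJensen
open Summit.QuantumFields.BalabanUV.Beta.GAN24.DerivativeRateTransferJensenMeanZero

/-! ## §1 The consistent pair `κ₂ ≤ c·κ²`; the END fed by PART 22's loop letter -/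

section Consistent

variable {o μ ν β β' : Type*} [Fintype o] [DecidableEq o] [Fintype μ] [DecidableEq μ] [Fintype ν] [Fintype β] [DecidableEq β] [Fintype β']
variable {q : μ → ν → ℝ} {W : μ → ν → Matrix o o ℝ} {Q : Matrix (μ × o) (ν × o) ℝ}
variable {src tgt : β → ν} {R : β → Matrix o o ℝ} {src' tgt' : β' → μ} {R' : β' → Matrix o o ℝ}
variable {Hf : Matrix (ν × o) (ν × o) ℝ} {Hc : Matrix (μ × o) (μ × o) ℝ} {wf wc : ℝ}
variable {σ : β' → ν ≃ ν} {ℓ : ℕ} {xs : β' → ν → ℕ → ν} {γ : β' → ν → ℕ → β} {T : β' → ν → ℕ → Matrix o o ℝ} {m : ℝ}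
variable {N : β' → ν → Matrix o o ℝ} {Φ : (ν × o → ℝ) → μ → ℝ} {ϖ d' κ κ₂ : ℝ}

/-- arithmetic of the consistent choice `t = κ`, `r = 1`, `κ₂ ≤ c·κ²`. [folklore] -/
theorem consistent_coeffs {κ κ₂ c ϖ X Y : ℝ} (hκ : 0 < κ) (hκ₂ : 0 ≤ κ₂) (hκ₂c : κ₂ ≤ c * κ ^ 2) (hϖ : 0 ≤ ϖ) (hY : 0 ≤ Y) :
    (1 + κ + (1 + κ⁻¹) * (1 + 1) * ϖ * κ ^ 2) * X + (1 + κ⁻¹) * (1 + (1 : ℝ)⁻¹) * κ₂ ^ 2 * Y ≤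
      (1 + (1 + 2 * ϖ * (1 + κ)) * κ) * X + 2 * c ^ 2 * (1 + κ) * κ ^ 3 * Y := by
  have hk : κ⁻¹ * κ = 1 := inv_mul_cancel₀ hκ.ne'
  have e1 : (1 + κ + (1 + κ⁻¹) * (1 + 1) * ϖ * κ ^ 2) = 1 + (1 + 2 * ϖ * (1 + κ)) * κ := by
    have : (1 + κ⁻¹) * κ ^ 2 = κ ^ 2 + κ := by rw [add_mul, one_mul, pow_two, ← mul_assoc, hk, one_mul]
    nlinarith [this]
  have hsq : κ₂ ^ 2 ≤ (c * κ ^ 2) ^ 2 := pow_le_pow_left₀ hκ₂ hκ₂c 2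
  have e2 : (1 + κ⁻¹) * (1 + (1 : ℝ)⁻¹) * (c * κ ^ 2) ^ 2 = 2 * c ^ 2 * (1 + κ) * κ ^ 3 := by
    have : (1 + κ⁻¹) * κ ^ 4 = κ ^ 4 + κ ^ 3 := by
      rw [add_mul, one_mul, show κ ^ 4 = κ * κ ^ 3 by ring, ← mul_assoc, hk, one_mul]
    rw [inv_one]; nlinarith [this]
  have hpos : (0 : ℝ) ≤ (1 + κ⁻¹) * (1 + (1 : ℝ)⁻¹) := by positivity
  rw [e1, ← e2]
  exact add_le_add le_rfl (mul_le_mul_of_nonneg_right (mul_le_mul_of_nonneg_left hsq hpos) hY)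

/-- **`covJensen_consistent` — THE CONSISTENT PAIR** [our proof]: under the hypotheses of `covJensen_meanZero` with `0 < κ`, `0 ≤ κ₂ ≤ c·κ²` (the mean
root-frame defect is SECOND order — Bałaban's averaged coarse link), `0 ≤ ϖ`, `0 ≤ d′`:
`⟨Qu, H_cQu⟩ ≤ (1 + (1 + 2ϖ(1+κ))·κ)·⟨u, H_f u⟩ + 2c²(1+κ)·κ³·w_c·d′·⟨Qu, Qu⟩` — relative slack `O(κ)`, additive slack `O(κ³)`. -/
theorem covJensen_consistent
    (hq : ∀ y x, 0 ≤ q y x) (hq1 : ∀ y, ∑ x, q y x ≤ 1) (hW : ∀ y x, (W y x)ᵀ * W y x = 1) (hR : ∀ e, (R e)ᵀ * R e = 1)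
    (hR' : ∀ e', (R' e')ᵀ * R' e' = 1)
    (hQ : ∀ (u : ν × o → ℝ) (y : μ), (fun a => (Q *ᵥ u) (y, a)) = ∑ x, q y x • (W y x *ᵥ fun b => u (x, b)))
    (hwc : 0 ≤ wc)
    (hHc : ∀ v : μ × o → ℝ, v ⬝ᵥ (Hc *ᵥ v) ≤
      wc * ∑ e', ((R' e' *ᵥ fun a => v (tgt' e', a)) - fun a => v (src' e', a)) ⬝ᵥ
        ((R' e' *ᵥ fun a => v (tgt' e', a)) - fun a => v (src' e', a)))
    (hHf : ∀ u : ν × o → ℝ, wf * ∑ e, ((R e *ᵥ fun b => u (tgt e, b)) - fun b => u (src e, b)) ⬝ᵥ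
        ((R e *ᵥ fun b => u (tgt e, b)) - fun b => u (src e, b)) ≤ u ⬝ᵥ (Hf *ᵥ u))
    (hσq : ∀ e' x, q (tgt' e') (σ e' x) = q (src' e') x)
    (hx0 : ∀ e' x, xs e' x 0 = x) (hxℓ : ∀ e' x, xs e' x ℓ = σ e' x)
    (hsrc : ∀ e' x i, i < ℓ → src (γ e' x i) = xs e' x i) (htgt : ∀ e' x i, i < ℓ → tgt (γ e' x i) = xs e' x (i + 1))
    (hT0 : ∀ e' x, T e' x 0 = 1) (hT : ∀ e' x i, i < ℓ → T e' x (i + 1) = T e' x i * R (γ e' x i))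
    (hmult : ∀ e, ∑ e', ∑ x, ∑ i ∈ range ℓ, (if γ e' x i = e then q (src' e') x else 0) ≤ m)
    (hw : wc * ℓ * m ≤ wf)
    (hNdef : ∀ e' x, N e' x = 1 - W (src' e') x * T e' x ℓ * (W (tgt' e') (σ e' x))ᵀ * (R' e')ᵀ)
    (hN : ∀ e' x (w : o → ℝ), (N e' x *ᵥ w) ⬝ᵥ (N e' x *ᵥ w) ≤ κ ^ 2 * (w ⬝ᵥ w))
    (hM : ∀ e' (w : o → ℝ), ((∑ x, q (src' e') x • N e' x) *ᵥ w) ⬝ᵥ ((∑ x, q (src' e') x • N e' x) *ᵥ w) ≤ κ₂ ^ 2 * (w ⬝ᵥ w))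
    (u : ν × o → ℝ)
    (hP : ∀ y, ∑ x, q y x * (((W y x *ᵥ fun b => u (x, b)) - fun a => (Q *ᵥ u) (y, a)) ⬝ᵥ
        ((W y x *ᵥ fun b => u (x, b)) - fun a => (Q *ᵥ u) (y, a))) ≤ Φ u y)
    (hΦ : wc * ∑ e', Φ u (tgt' e') ≤ ϖ * (u ⬝ᵥ (Hf *ᵥ u)))
    (hdeg : ∀ y, ((Finset.univ.filter fun e' => tgt' e' = y).card : ℝ) ≤ d')
    {c : ℝ} (hκ : 0 < κ) (hκ₂ : 0 ≤ κ₂) (hκ₂c : κ₂ ≤ c * κ ^ 2) (hϖ : 0 ≤ ϖ) (hd' : 0 ≤ d') :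
    (Q *ᵥ u) ⬝ᵥ (Hc *ᵥ (Q *ᵥ u)) ≤
      (1 + (1 + 2 * ϖ * (1 + κ)) * κ) * (u ⬝ᵥ (Hf *ᵥ u)) + 2 * c ^ 2 * (1 + κ) * κ ^ 3 * wc * d' * ((Q *ᵥ u) ⬝ᵥ (Q *ᵥ u)) := by
  have h := covJensen_meanZero hq hq1 hW hR hR' hQ hwc hHc hHf hσq hx0 hxℓ hsrc htgt hT0 hT hmult hw hNdef hN hM u hP hΦ hdeg hκ one_pos
  have hY : 0 ≤ wc * d' * ((Q *ᵥ u) ⬝ᵥ (Q *ᵥ u)) := mul_nonneg (mul_nonneg hwc hd') (dotProduct_self_nonneg' _)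
  have key := consistent_coeffs (X := u ⬝ᵥ (Hf *ᵥ u)) (Y := wc * d' * ((Q *ᵥ u) ⬝ᵥ (Q *ᵥ u))) hκ hκ₂ hκ₂c hϖ hY
  refine h.trans (le_trans (le_of_eq ?_) (key.trans (le_of_eq ?_))) <;> ring

/-- **`covJensen_meanZero_of_loop` — THE SAME END FED BY PART 22's LOOP LETTER**: PART 22's pointwise hypothesis
`|(V(e′,x) − 1)w|² ≤ κ²|w|²`, `V = W(src′e′,x)ᵀR′W(tgt′e′,σx)T_ℓᵀ`, implies the root-frame pointwise bound `hN` (§2 `rootDefect_le`), so the END holds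
with PART 22's `κ` verbatim plus the mean letter `κ₂`. [our proof] -/
theorem covJensen_meanZero_of_loop
    (hq : ∀ y x, 0 ≤ q y x) (hq1 : ∀ y, ∑ x, q y x ≤ 1) (hW : ∀ y x, (W y x)ᵀ * W y x = 1) (hR : ∀ e, (R e)ᵀ * R e = 1)
    (hR' : ∀ e', (R' e')ᵀ * R' e' = 1)
    (hQ : ∀ (u : ν × o → ℝ) (y : μ), (fun a => (Q *ᵥ u) (y, a)) = ∑ x, q y x • (W y x *ᵥ fun b => u (x, b)))
    (hwc : 0 ≤ wc)
    (hHc : ∀ v : μ × o → ℝ, v ⬝ᵥ (Hc *ᵥ v) ≤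
      wc * ∑ e', ((R' e' *ᵥ fun a => v (tgt' e', a)) - fun a => v (src' e', a)) ⬝ᵥ
        ((R' e' *ᵥ fun a => v (tgt' e', a)) - fun a => v (src' e', a)))
    (hHf : ∀ u : ν × o → ℝ, wf * ∑ e, ((R e *ᵥ fun b => u (tgt e, b)) - fun b => u (src e, b)) ⬝ᵥ
        ((R e *ᵥ fun b => u (tgt e, b)) - fun b => u (src e, b)) ≤ u ⬝ᵥ (Hf *ᵥ u))
    (hσq : ∀ e' x, q (tgt' e') (σ e' x) = q (src' e') x)
    (hx0 : ∀ e' x, xs e' x 0 = x) (hxℓ : ∀ e' x, xs e' x ℓ = σ e' x)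
    (hsrc : ∀ e' x i, i < ℓ → src (γ e' x i) = xs e' x i) (htgt : ∀ e' x i, i < ℓ → tgt (γ e' x i) = xs e' x (i + 1))
    (hT0 : ∀ e' x, T e' x 0 = 1) (hT : ∀ e' x i, i < ℓ → T e' x (i + 1) = T e' x i * R (γ e' x i))
    (hmult : ∀ e, ∑ e', ∑ x, ∑ i ∈ range ℓ, (if γ e' x i = e then q (src' e') x else 0) ≤ m)
    (hw : wc * ℓ * m ≤ wf)
    (hNdef : ∀ e' x, N e' x = 1 - W (src' e') x * T e' x ℓ * (W (tgt' e') (σ e' x))ᵀ * (R' e')ᵀ)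
    (hV : ∀ e' x (w : o → ℝ),
      (((W (src' e') x)ᵀ * R' e' * W (tgt' e') (σ e' x) * (T e' x ℓ)ᵀ - 1) *ᵥ w) ⬝ᵥ
          (((W (src' e') x)ᵀ * R' e' * W (tgt' e') (σ e' x) * (T e' x ℓ)ᵀ - 1) *ᵥ w) ≤ κ ^ 2 * (w ⬝ᵥ w))
    (hM : ∀ e' (w : o → ℝ), ((∑ x, q (src' e') x • N e' x) *ᵥ w) ⬝ᵥ ((∑ x, q (src' e') x • N e' x) *ᵥ w) ≤ κ₂ ^ 2 * (w ⬝ᵥ w))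
    (u : ν × o → ℝ)
    (hP : ∀ y, ∑ x, q y x * (((W y x *ᵥ fun b => u (x, b)) - fun a => (Q *ᵥ u) (y, a)) ⬝ᵥ
        ((W y x *ᵥ fun b => u (x, b)) - fun a => (Q *ᵥ u) (y, a))) ≤ Φ u y)
    (hΦ : wc * ∑ e', Φ u (tgt' e') ≤ ϖ * (u ⬝ᵥ (Hf *ᵥ u)))
    (hdeg : ∀ y, ((Finset.univ.filter fun e' => tgt' e' = y).card : ℝ) ≤ d')
    {t r : ℝ} (ht : 0 < t) (hr : 0 < r) :
    (Q *ᵥ u) ⬝ᵥ (Hc *ᵥ (Q *ᵥ u)) ≤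
      (1 + t + (1 + t⁻¹) * (1 + r) * ϖ * κ ^ 2) * (u ⬝ᵥ (Hf *ᵥ u)) +
        (1 + t⁻¹) * (1 + r⁻¹) * κ₂ ^ 2 * wc * d' * ((Q *ᵥ u) ⬝ᵥ (Q *ᵥ u)) := by
  have hN : ∀ e' x (w : o → ℝ), (N e' x *ᵥ w) ⬝ᵥ (N e' x *ᵥ w) ≤ κ ^ 2 * (w ⬝ᵥ w) := fun e' x w => by
    have hTl : (T e' x ℓ)ᵀ * T e' x ℓ = 1 :=
      orthogonal_partialTransport (R := fun i => R (γ e' x i)) (fun i _ => hR _) (hT0 e' x) (fun i hi => hT e' x i hi) ℓ le_rfl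
    rw [hNdef e' x]
    exact rootDefect_le (hW (src' e') x) (hW (tgt' e') (σ e' x)) (hR' e') hTl (hV e' x) w
  exact covJensen_meanZero hq hq1 hW hR hR' hQ hwc hHc hHf hσq hx0 hxℓ hsrc htgt hT0 hT hmult hw hNdef hN hM u hP hΦ hdeg ht hr

end Consistent

/-! ## §2 THE ABELIAN DICTIONARY: rotations of `ℝ²`; loop angles of block mean zero ⟹ `κ₂ ≤ κ²` -/

section Abelian

/-- `|(1 − ρ(φ))w|² = (2 − 2cos φ)·|w|²` for the rotation `ρ(φ) = [[cos φ, −sin φ],[sin φ, cos φ]]` of `ℝ²`. [folklore] -/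
theorem rot_defect_self (φ : ℝ) (w : Fin 2 → ℝ) :
    (((1 : Matrix (Fin 2) (Fin 2) ℝ) - !![Real.cos φ, -Real.sin φ; Real.sin φ, Real.cos φ]) *ᵥ w) ⬝ᵥ
        (((1 : Matrix (Fin 2) (Fin 2) ℝ) - !![Real.cos φ, -Real.sin φ; Real.sin φ, Real.cos φ]) *ᵥ w) =
      (2 - 2 * Real.cos φ) * (w ⬝ᵥ w) := by
  have hcs := Real.cos_sq_add_sin_sq φ
  simp [Matrix.mulVec, dotProduct, Fin.sum_univ_two, Matrix.one_apply, Matrix.sub_apply]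
  nlinarith [hcs]

/-- **`rot_defect_le_sq`**: `|(1 − ρ(φ))w|² ≤ φ²·|w|²` (`2 − 2cos φ ≤ φ²`, `Real.one_sub_sq_div_two_le_cos`) — the POINTWISE letter `κ = a` on `|φ| ≤ a`.
[folklore] -/
theorem rot_defect_le_sq (φ : ℝ) (w : Fin 2 → ℝ) :
    (((1 : Matrix (Fin 2) (Fin 2) ℝ) - !![Real.cos φ, -Real.sin φ; Real.sin φ, Real.cos φ]) *ᵥ w) ⬝ᵥ
        (((1 : Matrix (Fin 2) (Fin 2) ℝ) - !![Real.cos φ, -Real.sin φ; Real.sin φ, Real.cos φ]) *ᵥ w) ≤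
      φ ^ 2 * (w ⬝ᵥ w) := by
  rw [rot_defect_self]
  have h := Real.one_sub_sq_div_two_le_cos (x := φ)
  exact mul_le_mul_of_nonneg_right (by nlinarith [h]) (dotProduct_self_nonneg' _)

/-- `|sin φ − φ| ≤ |φ|³/4` (`Real.sin_lt`, `Real.sin_gt_sub_cube`: `x − x³/6 < sin x < x` for `x > 0`; oddness). [folklore] -/
theorem abs_sin_sub_self_le (φ : ℝ) : |Real.sin φ - φ| ≤ |φ| ^ 3 / 4 := by
  -- the positive half-line first
  have pos : ∀ x : ℝ, 0 < x → |Real.sin x - x| ≤ x ^ 3 / 4 := fun x hx => by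
    have h1 : Real.sin x < x := Real.sin_lt hx
    have h2 : x - x ^ 3 / 6 < Real.sin x := Real.sin_gt_sub_cube hx
    rw [abs_of_neg (by linarith)]
    nlinarith [pow_pos hx 3]
  rcases lt_trichotomy φ 0 with hlt | heq | hgt
  · have hφ' : 0 < -φ := by linarith
    have h := pos (-φ) hφ'
    rw [Real.sin_neg, show -Real.sin φ - -φ = -(Real.sin φ - φ) by ring, abs_neg] at h
    rwa [abs_of_neg hlt]
  · subst heq; simp
  · rw [abs_of_pos hgt]; exact pos φ hgt

/-- `|(Σ_x q_x(1 − ρ(φ_x)))w|² = ((Σ_x q_x(1 − cos φ_x))² + (Σ_x q_x sin φ_x)²)·|w|²` — the weighted mean of rotation defects is `A·1 − B′·J`. [folklore] -/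
theorem wsum_rot_defect_self {ν : Type*} [Fintype ν] (q φ : ν → ℝ) (w : Fin 2 → ℝ) :
    ((∑ x, q x • ((1 : Matrix (Fin 2) (Fin 2) ℝ) - !![Real.cos (φ x), -Real.sin (φ x); Real.sin (φ x), Real.cos (φ x)])) *ᵥ w) ⬝ᵥ
        ((∑ x, q x • ((1 : Matrix (Fin 2) (Fin 2) ℝ) - !![Real.cos (φ x), -Real.sin (φ x); Real.sin (φ x), Real.cos (φ x)])) *ᵥ w) =
      ((∑ x, q x * (1 - Real.cos (φ x))) ^ 2 + (∑ x, q x * Real.sin (φ x)) ^ 2) * (w ⬝ᵥ w) := by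
  have hM : (∑ x, q x • ((1 : Matrix (Fin 2) (Fin 2) ℝ) - !![Real.cos (φ x), -Real.sin (φ x); Real.sin (φ x), Real.cos (φ x)])) =
      !![∑ x, q x * (1 - Real.cos (φ x)), ∑ x, q x * Real.sin (φ x); -∑ x, q x * Real.sin (φ x), ∑ x, q x * (1 - Real.cos (φ x))] := by
    ext i j
    rw [Matrix.sum_apply]
    fin_cases i <;> fin_cases j <;> simp [Finset.sum_neg_distrib, mul_sub]
  rw [hM]
  simp [Matrix.mulVec, dotProduct, Fin.sum_univ_two]
  ring

/-- **`wsum_rot_defect_le_of_mean_zero` — LOOP ANGLES OF BLOCK MEAN ZERO ⟹ THE MEAN DEFECT IS SECOND ORDER** [our proof]: weights `q ≥ 0` with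
`Σ_x q_x = 1`, angles `|φ_x| ≤ a ≤ 1` with `Σ_x q_x φ_x = 0` ⟹ `|(Σ_x q_x(1 − ρ(φ_x)))w|² ≤ (a²)²·|w|²`, i.e. `κ₂ ≤ a² = κ²` for the pointwise `κ = a` of
`rot_defect_le_sq`: Bałaban's averaged coarse link makes the pair CONSISTENT with `c = 1` in PART 47 ∕ §1. -/
theorem wsum_rot_defect_le_of_mean_zero {ν : Type*} [Fintype ν] {q φ : ν → ℝ} {a : ℝ} (hq : ∀ x, 0 ≤ q x) (hq1 : ∑ x, q x = 1)
    (ha : ∀ x, |φ x| ≤ a) (ha1 : a ≤ 1) (hmean : ∑ x, q x * φ x = 0) (w : Fin 2 → ℝ) :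
    ((∑ x, q x • ((1 : Matrix (Fin 2) (Fin 2) ℝ) - !![Real.cos (φ x), -Real.sin (φ x); Real.sin (φ x), Real.cos (φ x)])) *ᵥ w) ⬝ᵥ
        ((∑ x, q x • ((1 : Matrix (Fin 2) (Fin 2) ℝ) - !![Real.cos (φ x), -Real.sin (φ x); Real.sin (φ x), Real.cos (φ x)])) *ᵥ w) ≤
      (a ^ 2) ^ 2 * (w ⬝ᵥ w) := by
  rw [wsum_rot_defect_self]
  refine mul_le_mul_of_nonneg_right ?_ (dotProduct_self_nonneg' _)
  have ha0 : 0 ≤ a := by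
    obtain ⟨x⟩ : Nonempty ν := by
      by_contra h; rw [not_nonempty_iff] at h; simp at hq1
    exact (abs_nonneg _).trans (ha x)
  -- A := Σ q (1 − cos φ) ∈ [0, a²/2]
  have hA0 : 0 ≤ ∑ x, q x * (1 - Real.cos (φ x)) :=
    Finset.sum_nonneg fun x _ => mul_nonneg (hq x) (by linarith [Real.cos_le_one (φ x)])
  have hA : ∑ x, q x * (1 - Real.cos (φ x)) ≤ a ^ 2 / 2 := by
    calc ∑ x, q x * (1 - Real.cos (φ x)) ≤ ∑ x, q x * (a ^ 2 / 2) := Finset.sum_le_sum fun x _ => by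
            refine mul_le_mul_of_nonneg_left ?_ (hq x)
            have h := Real.one_sub_sq_div_two_le_cos (x := φ x)
            have : φ x ^ 2 ≤ a ^ 2 := by
              have := ha x; rw [← sq_abs]; exact pow_le_pow_left₀ (abs_nonneg _) this 2
            linarith
      _ = a ^ 2 / 2 := by rw [← Finset.sum_mul, hq1, one_mul]
  -- B′ := Σ q sin φ = Σ q (sin φ − φ), |B′| ≤ a³/4
  have hB : |∑ x, q x * Real.sin (φ x)| ≤ a ^ 3 / 4 := by
    have e : ∑ x, q x * Real.sin (φ x) = ∑ x, q x * (Real.sin (φ x) - φ x) := by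
      rw [← sub_zero (∑ x, q x * Real.sin (φ x)), ← hmean, ← Finset.sum_sub_distrib]
      exact Finset.sum_congr rfl fun x _ => by ring
    rw [e]
    refine (Finset.abs_sum_le_sum_abs _ _).trans ?_
    calc ∑ x, |q x * (Real.sin (φ x) - φ x)| ≤ ∑ x, q x * (a ^ 3 / 4) := Finset.sum_le_sum fun x _ => by
            rw [abs_mul, abs_of_nonneg (hq x)]
            refine mul_le_mul_of_nonneg_left ?_ (hq x)
            have h := abs_sin_sub_self_le (φ x)
            have : |φ x| ^ 3 ≤ a ^ 3 := pow_le_pow_left₀ (abs_nonneg _) (ha x) 3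
            linarith
      _ = a ^ 3 / 4 := by rw [← Finset.sum_mul, hq1, one_mul]
  have hB2 : (∑ x, q x * Real.sin (φ x)) ^ 2 ≤ (a ^ 3 / 4) ^ 2 := by
    rw [← sq_abs]; exact pow_le_pow_left₀ (abs_nonneg _) hB 2
  have hA2 : (∑ x, q x * (1 - Real.cos (φ x))) ^ 2 ≤ (a ^ 2 / 2) ^ 2 := pow_le_pow_left₀ hA0 hA 2
  have ha2 : a ^ 2 ≤ 1 := by nlinarith
  nlinarith [hA2, hB2, ha2, pow_nonneg ha0 4, pow_nonneg ha0 6]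

end Abelian

/-! ## §3 The abelian END: Bałaban's averaged coarse link ⟹ (STAB-ε,δ) with third-order additive slack -/

section AbelianEnd

variable {μ ν β β' : Type*} [Fintype μ] [DecidableEq μ] [Fintype ν] [Fintype β] [DecidableEq β] [Fintype β']
variable {q : μ → ν → ℝ} {src tgt : β → ν} {src' tgt' : β' → μ} {wf wc : ℝ}
variable {σ : β' → ν ≃ ν} {ℓ : ℕ} {xs : β' → ν → ℕ → ν} {γ : β' → ν → ℕ → β} {m : ℝ} {ϖ d' : ℝ}

/-- **`covJensen_abelian_meanZero` — BAŁABAN's AVERAGED COARSE LINK IN THE ABELIAN MODEL ⟹ (STAB-ε,δ) WITH THIRD-ORDER ADDITIVE SLACK** [our proof]: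
PART 47's letters on the colour space `ℝ²` where every root-frame loop transport IS a rotation, `W(y,x)·T_x·W(y′,σx)ᵀ·R′ᵀ = ρ(φ(e′,x))`, with angles
`|φ| ≤ a ≤ 1`, `0 < a`, of block mean ZERO `Σ_x q(y,x)·φ(e′,x) = 0` (the coarse link defined as the average of the loop transports) and exact block weights
`Σ_x q(y,x) = 1`: then `κ = a`, `κ₂ = a²` and `⟨Qu, H_cQu⟩ ≤ (1 + (1 + 2ϖ(1+a))·a)·⟨u, H_f u⟩ + 2(1+a)·a³·w_c·d′·⟨Qu, Qu⟩`. -/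
theorem covJensen_abelian_meanZero
    {W : μ → ν → Matrix (Fin 2) (Fin 2) ℝ} {Q : Matrix (μ × Fin 2) (ν × Fin 2) ℝ}
    {R : β → Matrix (Fin 2) (Fin 2) ℝ} {R' : β' → Matrix (Fin 2) (Fin 2) ℝ}
    {Hf : Matrix (ν × Fin 2) (ν × Fin 2) ℝ} {Hc : Matrix (μ × Fin 2) (μ × Fin 2) ℝ}
    {T : β' → ν → ℕ → Matrix (Fin 2) (Fin 2) ℝ} {N : β' → ν → Matrix (Fin 2) (Fin 2) ℝ} {Φ : (ν × Fin 2 → ℝ) → μ → ℝ}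
    (hq : ∀ y x, 0 ≤ q y x) (hq1 : ∀ y, ∑ x, q y x = 1) (hW : ∀ y x, (W y x)ᵀ * W y x = 1) (hR : ∀ e, (R e)ᵀ * R e = 1)
    (hR' : ∀ e', (R' e')ᵀ * R' e' = 1)
    (hQ : ∀ (u : ν × Fin 2 → ℝ) (y : μ), (fun a => (Q *ᵥ u) (y, a)) = ∑ x, q y x • (W y x *ᵥ fun b => u (x, b)))
    (hwc : 0 ≤ wc)
    (hHc : ∀ v : μ × Fin 2 → ℝ, v ⬝ᵥ (Hc *ᵥ v) ≤
      wc * ∑ e', ((R' e' *ᵥ fun a => v (tgt' e', a)) - fun a => v (src' e', a)) ⬝ᵥ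
        ((R' e' *ᵥ fun a => v (tgt' e', a)) - fun a => v (src' e', a)))
    (hHf : ∀ u : ν × Fin 2 → ℝ, wf * ∑ e, ((R e *ᵥ fun b => u (tgt e, b)) - fun b => u (src e, b)) ⬝ᵥ
        ((R e *ᵥ fun b => u (tgt e, b)) - fun b => u (src e, b)) ≤ u ⬝ᵥ (Hf *ᵥ u))
    (hσq : ∀ e' x, q (tgt' e') (σ e' x) = q (src' e') x)
    (hx0 : ∀ e' x, xs e' x 0 = x) (hxℓ : ∀ e' x, xs e' x ℓ = σ e' x)
    (hsrc : ∀ e' x i, i < ℓ → src (γ e' x i) = xs e' x i) (htgt : ∀ e' x i, i < ℓ → tgt (γ e' x i) = xs e' x (i + 1))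
    (hT0 : ∀ e' x, T e' x 0 = 1) (hT : ∀ e' x i, i < ℓ → T e' x (i + 1) = T e' x i * R (γ e' x i))
    (hmult : ∀ e, ∑ e', ∑ x, ∑ i ∈ range ℓ, (if γ e' x i = e then q (src' e') x else 0) ≤ m)
    (hw : wc * ℓ * m ≤ wf)
    (hNdef : ∀ e' x, N e' x = 1 - W (src' e') x * T e' x ℓ * (W (tgt' e') (σ e' x))ᵀ * (R' e')ᵀ)
    {φ : β' → ν → ℝ} {a : ℝ}
    (hrot : ∀ e' x, W (src' e') x * T e' x ℓ * (W (tgt' e') (σ e' x))ᵀ * (R' e')ᵀ =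
      !![Real.cos (φ e' x), -Real.sin (φ e' x); Real.sin (φ e' x), Real.cos (φ e' x)])
    (ha0 : 0 < a) (ha : ∀ e' x, |φ e' x| ≤ a) (ha1 : a ≤ 1) (hmean : ∀ e', ∑ x, q (src' e') x * φ e' x = 0)
    (u : ν × Fin 2 → ℝ)
    (hP : ∀ y, ∑ x, q y x * (((W y x *ᵥ fun b => u (x, b)) - fun a => (Q *ᵥ u) (y, a)) ⬝ᵥ
        ((W y x *ᵥ fun b => u (x, b)) - fun a => (Q *ᵥ u) (y, a))) ≤ Φ u y)
    (hΦ : wc * ∑ e', Φ u (tgt' e') ≤ ϖ * (u ⬝ᵥ (Hf *ᵥ u)))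
    (hdeg : ∀ y, ((Finset.univ.filter fun e' => tgt' e' = y).card : ℝ) ≤ d') (hϖ : 0 ≤ ϖ) (hd' : 0 ≤ d') :
    (Q *ᵥ u) ⬝ᵥ (Hc *ᵥ (Q *ᵥ u)) ≤
      (1 + (1 + 2 * ϖ * (1 + a)) * a) * (u ⬝ᵥ (Hf *ᵥ u)) + 2 * (1 + a) * a ^ 3 * wc * d' * ((Q *ᵥ u) ⬝ᵥ (Q *ᵥ u)) := by
  have hNrot : ∀ e' x, N e' x = 1 - !![Real.cos (φ e' x), -Real.sin (φ e' x); Real.sin (φ e' x), Real.cos (φ e' x)] := fun e' x => by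
    rw [hNdef e' x, hrot e' x]
  have hN : ∀ e' x (w : Fin 2 → ℝ), (N e' x *ᵥ w) ⬝ᵥ (N e' x *ᵥ w) ≤ a ^ 2 * (w ⬝ᵥ w) := fun e' x w => by
    rw [hNrot e' x]
    refine (rot_defect_le_sq (φ e' x) w).trans (mul_le_mul_of_nonneg_right ?_ (dotProduct_self_nonneg' _))
    have h := ha e' x
    rw [← sq_abs]; exact pow_le_pow_left₀ (abs_nonneg _) h 2
  have hM : ∀ e' (w : Fin 2 → ℝ), ((∑ x, q (src' e') x • N e' x) *ᵥ w) ⬝ᵥ ((∑ x, q (src' e') x • N e' x) *ᵥ w) ≤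
      (a ^ 2) ^ 2 * (w ⬝ᵥ w) := fun e' w => by
    simp_rw [hNrot e']
    exact wsum_rot_defect_le_of_mean_zero (fun x => hq _ x) (hq1 _) (fun x => ha e' x) ha1 (hmean e') w
  refine (covJensen_consistent hq (fun y => (hq1 y).le) hW hR hR' hQ hwc hHc hHf hσq hx0 hxℓ hsrc htgt hT0 hT hmult hw hNdef hN hM u hP hΦ
    hdeg ha0 (sq_nonneg a) (le_of_eq (one_mul _).symm) hϖ hd').trans (le_of_eq ?_)
  ring

end AbelianEnd

end Summit.QuantumFields.BalabanUV.Beta.GAN24.DerivativeRateTransferJensenMeanZeroEnd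

end
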